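import Mathlib
import Summits.SmoothPoincare4.SmoothPoincare4.Theorems.SullivanDualTameOrBrodyR4DeepReduction6
import Summits.SmoothPoincare4.SmoothPoincare4.Theorems.SullivanDualTameOrBrodyR4StubLocalFamilyUnique
import Summits.SmoothPoincare4.SmoothPoincare4.Theorems.SullivanDualTameOrBrodyR4HelperImmersedLimitsOfNoCusp

/-!
# Crux `TameOrBrodyR4` (stmt-SmoothPoincare4-7826) modulo McDuff's no-cusp theorem (line `Sketch`, lead c6)

`helper_tameOrBrodyR4OfNoCusp`: the route declaration `Theses.SullivanDual.TameOrBrodyR4` follows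
from the single Literature named fact
`Literature.Geometry.Symplectic.jHolomorphic_immersed_of_limitEmbedded_punctured` (D. McDuff,
J. Differential Geom. 34 (1991), Thm 1.4 / Cor. 4.4: no cusps in limits of embedded `J`-curves).
Composition of the tree's kernel reduction `TameOrBrodyR4_of_deep2` with the two deep inputs of
the line: CORE-A `stub_localFamilyUnique` (PROVED, `…StubLocalFamilyUnique.lean`) and CORE-B in the
form `helper_immersedLimitsOfNoCusp` (PROVED modulo the named fact).
-/

-- the registered namespace `Summit.SmoothPoincare4.SmoothPoincare4.…` repeats a component
set_option linter.dupNamespace false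

noncomputable section

namespace Summit.SmoothPoincare4.SmoothPoincare4.Cruxes.TameOrBrodyR4.Sketch

/-- **Registered helper `helper_tameOrBrodyR4OfNoCusp`: the crux modulo McDuff's no-cusp
theorem.** -/
theorem helper_tameOrBrodyR4OfNoCusp :
    Literature.Geometry.Symplectic.jHolomorphic_immersed_of_limitEmbedded_punctured →
      Summit.SmoothPoincare4.SmoothPoincare4.Theses.SullivanDual.TameOrBrodyR4 :=
  fun hCusp => TameOrBrodyR4_of_deep2 stub_localFamilyUnique (helper_immersedLimitsOfNoCusp hCusp)

end Summit.SmoothPoincare4.SmoothPoincare4.Cruxes.TameOrBrodyR4.Sketch
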